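import Mathlib
import Summits.Ventures.HodgeRepro.Tier4.Line1.RTFSetting
import Summits.Ventures.HodgeRepro.Tier4.Line1.RtfUnfold
import Summits.Ventures.HodgeRepro.Tier4.Line1.RelClosed
import Summits.Ventures.HodgeRepro.Tier4.Line4.MaximalFamilyClosed

/-!
# Tier4/Line4/L1Closed — C-L4-L1CLOSED: closed invariant constituents are stable under `R(f)` for `f ∈ L¹`

Blind re-derivation cell `pub-hodge-repro`, Tier 4 «prove the step» (README §9–§10), seat t4-L2-p2 g4 on plan-4 g4's
cut C-L4-L1CLOSED (S14751; TAKEN S14761).  The tree's `IsInvariantSubspace.conv` stabilises a constituent under `R(f)`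
for a TEST function `f` (continuous, compact support).  For an `L¹` test function — continuous and integrable, not
compactly supported (the archimedean pseudo-coefficient of §15) — a CLOSED constituent (`IsClosedSub`, L4-p1's
MaximalFamilyClosed: every continuous invariant `L²(D_G)`-limit of members is a member) is still stable:
`R(f)φ` is continuous and invariant, and it is the `L²(D_G)`-limit of `R(f·χ_n)φ` for cutoffs `χ_n` (Urysohn
functions equal to `1` on a compact exhaustion), each of which lies in the constituent.

* `norm_R_le_of_integrable` — `‖R(f)φ(y)‖ ≤ ‖f‖₁ · B` for integrable `f` and `‖φ‖ ≤ B`;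
* `continuous_R_of_integrable` — continuity of `R(f)φ` (dominated convergence);
* `R_sub_left` — `R(f − f′)φ = R(f)φ − R(f′)φ` for integrable `f`, `f′` and bounded `φ`;
* `eLpNorm_R_restrict_le` — `‖R(h)φ‖_{L²(D_G)} ≤ μ(D_G)^{1/2} · ‖h‖₁ · B`;
* `exists_cutoff_tendsto` — cutoffs `χ n` with `IsTest (f · χ n)` and `‖f − f·χ n‖₁ → 0`;
* **`R_mem_of_isClosedSub`** — for `τ` invariant (`IsInvariantSubspace`) and closed (`IsClosedSub`), `φ ∈ τ`,
  `f` continuous and integrable: `R f φ ∈ τ` — the content of `AdaptedClosedUnderL1` (plan-4's §15 def, consumed by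
  the L1/L4 `L¹` layer; the named corollary is one line once the def is on the tree).

Hypotheses beyond the abstract `RTF.Setting G`: `G` first countable (dominated convergence for the continuity of
`R(f)φ`), locally compact and σ-compact (the cutoffs) — all three are theorems for `GA W` (`Line1.secondCountable_GA`,
`Line1.locallyCompact_GA`, `Line1.sigmaCompact_GA`).  Mathlib-level; no printed input.
HC_CM is NOT proved by anyone in this repository.
-/

set_option autoImplicit false
noncomputable section

namespace Summit.Ventures.HodgeRepro.Tier4.Line4

open MeasureTheory Topology Filter Summit.Ventures.HodgeRepro.Tier4.Line1 Summit.Ventures.HodgeRepro.Tier4.Line1.RTF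
open scoped ENNReal

section L1Closed

variable {G : Type} [Group G] [TopologicalSpace G] [IsTopologicalGroup G] [MeasurableSpace G] [BorelSpace G]
  (S : RTF.Setting G)

/-- The integrand of `R(f)φ(y)` is integrable for integrable `f` and a bounded measurable `φ`. -/
theorem integrable_R_integrand {f φ : G → ℂ} (hf : Integrable f S.μ) (hφm : Continuous φ) {B : ℝ}
    (hB : ∀ x, ‖φ x‖ ≤ B) (y : G) : Integrable (fun g => f g * φ (y * g)) S.μ := by
  have hmeas : AEStronglyMeasurable (fun g => φ (y * g)) S.μ :=
    (hφm.comp (continuous_const.mul continuous_id)).aestronglyMeasurable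
  have := hf.bdd_mul hmeas (Eventually.of_forall fun g => hB (y * g))
  simpa only [mul_comm] using this

omit [IsTopologicalGroup G] [BorelSpace G] in
/-- **The trivial bound** `‖R(f)φ(y)‖ ≤ ‖f‖₁ · B` for an integrable `f`. -/
theorem norm_R_le_of_integrable {f φ : G → ℂ} (hf : Integrable f S.μ) {B : ℝ} (hB : ∀ x, ‖φ x‖ ≤ B) (y : G) :
    ‖S.R f φ y‖ ≤ (∫ g, ‖f g‖ ∂S.μ) * B := by
  unfold RTF.Setting.R
  calc ‖∫ g, f g * φ (y * g) ∂S.μ‖ ≤ ∫ g, ‖f g * φ (y * g)‖ ∂S.μ := norm_integral_le_integral_norm _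
    _ ≤ ∫ g, ‖f g‖ * B ∂S.μ := by
        apply integral_mono_of_nonneg (Eventually.of_forall fun g => norm_nonneg _) (hf.norm.mul_const B)
        refine Eventually.of_forall fun g => ?_
        show ‖f g * φ (y * g)‖ ≤ ‖f g‖ * B
        rw [norm_mul]
        exact mul_le_mul_of_nonneg_left (hB _) (norm_nonneg _)
    _ = (∫ g, ‖f g‖ ∂S.μ) * B := integral_mul_const _ _

/-- **`R(f)φ` is continuous** for an integrable `f` and a bounded continuous `φ` (dominated convergence). -/
theorem continuous_R_of_integrable [FirstCountableTopology G] {f φ : G → ℂ} (hf : Integrable f S.μ)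
    (hφc : Continuous φ) {B : ℝ} (hB : ∀ x, ‖φ x‖ ≤ B) : Continuous (S.R f φ) := by
  unfold RTF.Setting.R
  refine continuous_of_dominated (bound := fun g => ‖f g‖ * B) ?_ ?_ (hf.norm.mul_const B) ?_
  · intro y
    exact (integrable_R_integrand S hf hφc hB y).aestronglyMeasurable
  · intro y
    refine Eventually.of_forall fun g => ?_
    show ‖f g * φ (y * g)‖ ≤ ‖f g‖ * B
    rw [norm_mul]
    exact mul_le_mul_of_nonneg_left (hB _) (norm_nonneg _)
  · refine Eventually.of_forall fun g => ?_
    exact continuous_const.mul (hφc.comp (continuous_id.mul continuous_const))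

/-- `R` is additive in the test function on integrable functions (bounded continuous `φ`). -/
theorem R_sub_left {f f' φ : G → ℂ} (hf : Integrable f S.μ) (hf' : Integrable f' S.μ) (hφc : Continuous φ)
    {B : ℝ} (hB : ∀ x, ‖φ x‖ ≤ B) (y : G) :
    S.R (fun g => f g - f' g) φ y = S.R f φ y - S.R f' φ y := by
  unfold RTF.Setting.R
  rw [← integral_sub (integrable_R_integrand S hf hφc hB y) (integrable_R_integrand S hf' hφc hB y)]
  congr 1
  ext g
  ring

omit [IsTopologicalGroup G] [BorelSpace G] in
/-- **The `L²(D_G)` bound** `‖R(h)φ‖_{L²(D_G)} ≤ μ(D_G)^{1/2} · ‖h‖₁ · B`. -/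
theorem eLpNorm_R_restrict_le {h φ : G → ℂ} (hh : Integrable h S.μ) {B : ℝ} (hB : ∀ x, ‖φ x‖ ≤ B) :
    eLpNorm (S.R h φ) 2 (S.μ.restrict S.DG) ≤
      (S.μ.restrict S.DG) Set.univ ^ (2 : ℝ≥0∞).toReal⁻¹ * ENNReal.ofReal ((∫ g, ‖h g‖ ∂S.μ) * B) :=
  eLpNorm_le_of_ae_bound (Eventually.of_forall fun y => norm_R_le_of_integrable S hh hB y)

/-- **Cutoffs**: on a locally compact σ-compact group, an integrable continuous `f` is the `L¹`-limit of the test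
functions `f · χ n`, `χ n` Urysohn functions equal to `1` on the `n`-th compact of an exhaustion. -/
theorem exists_cutoff_tendsto [LocallyCompactSpace G] [SigmaCompactSpace G] {f : G → ℂ} (hfc : Continuous f)
    (hf : Integrable f S.μ) :
    ∃ fn : ℕ → G → ℂ, (∀ n, IsTest (fn n)) ∧
      Tendsto (fun n => ∫ g, ‖f g - fn n g‖ ∂S.μ) atTop (𝓝 0) := by
  haveI := S.haar
  let K : CompactExhaustion G := CompactExhaustion.choice G
  -- Urysohn functions `χ n = 1` on `K n`, compactly supported, with values in `[0, 1]`
  have hχ : ∀ n : ℕ, ∃ χ : C(G, ℝ), Set.EqOn χ 1 (K n) ∧ HasCompactSupport χ ∧ ∀ x, χ x ∈ Set.Icc (0 : ℝ) 1 := by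
    intro n
    obtain ⟨χ, h1, -, hc, hI⟩ :=
      exists_continuous_one_zero_of_isCompact (K.isCompact n) isClosed_empty (Set.disjoint_empty _)
    exact ⟨χ, h1, hc, hI⟩
  choose χ hχ1 hχc hχI using hχ
  refine ⟨fun n g => f g * (χ n g : ℂ), fun n => ⟨?_, ?_⟩, ?_⟩
  · exact hfc.mul (Complex.continuous_ofReal.comp (χ n).continuous)
  · have : HasCompactSupport fun g => ((χ n g : ℝ) : ℂ) := (hχc n).comp_left Complex.ofReal_zero
    exact this.mul_left
  · -- dominated convergence: `‖f − f χ n‖ ≤ ‖f‖`, pointwise `→ 0`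
    have hlim : Tendsto (fun n => ∫ g, ‖f g - f g * (χ n g : ℂ)‖ ∂S.μ) atTop (𝓝 (∫ g, (0 : ℝ) ∂S.μ)) := by
      refine tendsto_integral_of_dominated_convergence (fun g => ‖f g‖) ?_ hf.norm ?_ ?_
      · intro n
        exact (hfc.sub (hfc.mul (Complex.continuous_ofReal.comp (χ n).continuous))).norm.aestronglyMeasurable
      · intro n
        refine Eventually.of_forall fun g => ?_
        rw [Real.norm_of_nonneg (norm_nonneg _), ← mul_one_sub, norm_mul]
        have h01 := hχI n g
        have : ‖(1 : ℂ) - (χ n g : ℂ)‖ ≤ 1 := by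
          rw [← Complex.ofReal_one, ← Complex.ofReal_sub, Complex.norm_real, Real.norm_of_nonneg (by linarith [h01.2])]
          linarith [h01.1]
        calc ‖f g‖ * ‖(1 : ℂ) - (χ n g : ℂ)‖ ≤ ‖f g‖ * 1 := mul_le_mul_of_nonneg_left this (norm_nonneg _)
          _ = ‖f g‖ := mul_one _
      · refine Eventually.of_forall fun g => ?_
        -- eventually `g ∈ K n`, so `χ n g = 1` and the difference vanishes
        obtain ⟨N, hN⟩ := K.exists_mem g
        refine tendsto_atTop_of_eventually_const (i₀ := N) fun n hn => ?_
        have hg : g ∈ K n := K.subset hn hN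
        rw [hχ1 n hg, Pi.one_apply, Complex.ofReal_one, mul_one, sub_self, norm_zero]
    simpa using hlim

/-- **C-L4-L1CLOSED, the content**: a closed invariant constituent is stable under `R(f)` for every continuous
integrable `f` — `R(f)φ` is continuous, invariant, and the `L²(D_G)`-limit of the members `R(f·χ n)φ`. -/
theorem R_mem_of_isClosedSub [FirstCountableTopology G] [LocallyCompactSpace G] [SigmaCompactSpace G]
    {τ : Set (G → ℂ)}
    (hinv : S.IsInvariantSubspace τ) (hcl : IsClosedSub S τ) {φ : G → ℂ} (hφ : φ ∈ τ) {f : G → ℂ}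
    (hfc : Continuous f) (hf : Integrable f S.μ) : S.R f φ ∈ τ := by
  have hφc : Continuous φ := hinv.cont φ hφ
  have hφi : S.Invariant φ := hinv.inv φ hφ
  obtain ⟨B, hB0, hB⟩ := S.exists_bound_of_invariant hφi hφc
  obtain ⟨fn, hfn, hlim⟩ := exists_cutoff_tendsto S hfc hf
  refine hcl _ (continuous_R_of_integrable S hf hφc hB) (S.R_invariant f hφi) fun ε hε => ?_
  -- the constant `c := μ(D_G)^{1/2} · B` and `n` with `c · ‖f − fn n‖₁ < ε`
  haveI := S.haar
  set c : ℝ := ((S.μ.restrict S.DG) Set.univ ^ (2 : ℝ≥0∞).toReal⁻¹).toReal * B with hc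
  have hc0 : 0 ≤ c := mul_nonneg ENNReal.toReal_nonneg hB0
  have hcfin : (S.μ.restrict S.DG) Set.univ ^ (2 : ℝ≥0∞).toReal⁻¹ ≠ ⊤ := by
    rw [Measure.restrict_apply_univ]
    exact ENNReal.rpow_ne_top_of_nonneg (by norm_num) S.measure_DG_ne_top
  have hsmall : ∀ᶠ n in atTop, (∫ g, ‖f g - fn n g‖ ∂S.μ) * c < ε := by
    have : Tendsto (fun n => (∫ g, ‖f g - fn n g‖ ∂S.μ) * c) atTop (𝓝 (0 * c)) := hlim.mul_const c
    rw [zero_mul] at this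
    exact this.eventually (gt_mem_nhds hε)
  obtain ⟨n, hn⟩ := hsmall.exists
  refine ⟨S.R (fn n) φ, hinv.conv φ hφ (fn n) (hfn n), ?_⟩
  have hfn_int : Integrable (fn n) S.μ := S.integrable_of_isTest (hfn n)
  have hdiff : (fun x => S.R f φ x - S.R (fn n) φ x) = S.R (fun g => f g - fn n g) φ := by
    ext y
    rw [R_sub_left S hf hfn_int hφc hB y]
  rw [hdiff]
  refine lt_of_le_of_lt (eLpNorm_R_restrict_le S (hf.sub hfn_int) hB) ?_
  rw [← ENNReal.ofReal_toReal hcfin, ← ENNReal.ofReal_mul ENNReal.toReal_nonneg]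
  refine (ENNReal.ofReal_lt_ofReal_iff hε).2 ?_
  calc ((S.μ.restrict S.DG) Set.univ ^ (2 : ℝ≥0∞).toReal⁻¹).toReal * ((∫ g, ‖f g - fn n g‖ ∂S.μ) * B)
      = (∫ g, ‖f g - fn n g‖ ∂S.μ) * c := by rw [hc]; ring
    _ < ε := hn

end L1Closed

end Summit.Ventures.HodgeRepro.Tier4.Line4

end
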